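import Mathlib
import Summits.AtomisticToContinuum.FouriersLaw.Theses.BondHeatUncertainty
import Summits.AtomisticToContinuum.FouriersLaw.Theses.JunctionLocality
import Summits.AtomisticToContinuum.FouriersLaw.Theses.BoundaryEscapeDeficit
import Summits.AtomisticToContinuum.FouriersLaw.Theses.PhononLorentzGas

/-!
# Route `BondHeatUncertainty` — import slot `PositiveOrInfiniteLimit`: the exact split and the
# boundary-escape supply line

Support for item `stmt-AtomisticToContinuum-9128`
(`Summit.AtomisticToContinuum.FouriersLaw.Theses.BondHeatUncertainty.PositiveOrInfiniteLimit`: under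
weak-NESS uniqueness, along every steady-state family of `pinnedChain ω₂ lam β γ` and every `T > 0`, the
response coefficients `D N` converge in `EReal` to some `ℓ ∈ (0, +∞]`).  The slot is the
positivity-and-convergence half of Fourier's law for a deterministic anharmonic bulk (open, BLR 2000
§6.3); the companion files `BondHeatUncertaintyPositiveOrInfiniteLimit{,Eventual,Harmonic,Slots}.lean`
land the Fekete / superadditive / Green–Kubo supply lines and the link to the sibling slot
`BoundedResponseConverges`.  This file adds, BY NAME:

* `conductanceLowerBound_of_positiveOrInfiniteLimit : PositiveOrInfiniteLimit →
  JunctionLocality.ConductanceLowerBound` — NECESSITY of the crux `stmt-AtomisticToContinuum-11749`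
  (shared by `JunctionLocality`, `ParityLiouvilleSeed`, `StaticAbelianSqueeze`): an `EReal` limit `ℓ > 0`
  forces `D N ≥ c > 0` eventually.  So item 9128 can never close before the content of 11749 holds,
  and 11749 is a co-hypothesis of two of its supply lines (`positiveOrInfiniteLimit_of_junctionLocality`,
  `positiveOrInfiniteLimit_of_quasiSubadditive_of_lowerBound`).
* `positiveOrInfiniteLimit_iff_conductanceLowerBound_and_regular` — the EXACT SPLIT of the slot into
  its two open halves: `ConductanceLowerBound` ("not an insulator") and `EReal`-regularity of
  `N ↦ D N` ("no oscillation": `liminf = limsup`, no value claimed — the shape of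
  `BoundaryEscapeDeficit.EscapeNonOscillation`, written for `D` itself).
* `positiveOrInfiniteLimit_of_boundaryEscapeDeficit : BoundaryEscapeDeficit.ResponseIdentity →
  BoundaryEscapeDeficit.EscapeLaw → PositiveOrInfiniteLimit` — the third supplier named by the planner
  ("EscapeDeficit's bracket + EscapeNonOscillation"; the live route is `BoundaryEscapeDeficit`, items
  12237 + 12234, or 12237 + 12235 + 12236 + 12238 through `EscapeLawOfCruxes` 12242): the response
  identity pins `D N = (N-1)·γ·E_N` for `N ≥ 1` (uniqueness of `δ`-limits along `𝓝[≠] 0`) and the escape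
  law sends that sequence to `κ_b > 0`.
* `escapeNonOscillation_of_positiveOrInfiniteLimit` — conversely, under `NessUnique` and
  `ResponseIdentity` the slot implies that route's own import slot `EscapeNonOscillation` (item 12238),
  along the canonical steady-state family given by the in-tree existence theorem
  `pinnedChain_exists_isSteadyState`.
* `phononLorentzGas_positiveOrInfiniteLimit_iff` — route `PhononLorentzGas`'s copy of the slot is the
  same statement (`Iff.rfl`), so everything here and in the companion files serves that route verbatim.

Nothing here closes item 9128.
-/

noncomputable section

open Filter Topology Set

namespace Summit.AtomisticToContinuum.FouriersLaw.Theorems.PositiveOrInfiniteLimit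

open Summit.AtomisticToContinuum.FouriersLaw.Theses
open Literature.MathematicalPhysics.KineticTheory.HeatConduction

/-! ## Sequence-level lemmas -/

/-- If `↑(D N) → ℓ` in `EReal` with `0 < ℓ`, then for some real `c > 0`, eventually `c ≤ D N`: choose a
real `c` strictly between `0` and `ℓ` (`EReal.exists_between_coe_real`); eventually `↑c < ↑(D N)`.
[folklore] -/
theorem exists_pos_eventually_le_of_ereal_tendsto (D : ℕ → ℝ) {ℓ : EReal} (hℓpos : 0 < ℓ)
    (hℓ : Tendsto (fun N : ℕ => ((D N : ℝ) : EReal)) atTop (𝓝 ℓ)) :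
    ∃ c : ℝ, 0 < c ∧ ∃ N₁ : ℕ, ∀ N : ℕ, N₁ ≤ N → c ≤ D N := by
  obtain ⟨c, h0c, hcℓ⟩ := EReal.exists_between_coe_real hℓpos
  have hev : ∀ᶠ N in atTop, ((c : ℝ) : EReal) < ((D N : ℝ) : EReal) := hℓ.eventually_const_lt hcℓ
  obtain ⟨N₁, hN₁⟩ := eventually_atTop.1 hev
  exact ⟨c, EReal.coe_pos.1 h0c, N₁, fun N hN => le_of_lt (EReal.coe_lt_coe_iff.1 (hN₁ N hN))⟩

/-- If eventually `c ≤ D N` with `c > 0` and `↑(D N) → ℓ` in `EReal`, then `0 < ℓ` (`↑c ≤ ℓ` by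
`ge_of_tendsto`). [folklore] -/
theorem ereal_limit_pos_of_eventually_le (D : ℕ → ℝ) {c : ℝ} (hc : 0 < c) {N₁ : ℕ}
    (hlb : ∀ N : ℕ, N₁ ≤ N → c ≤ D N) {ℓ : EReal}
    (hℓ : Tendsto (fun N : ℕ => ((D N : ℝ) : EReal)) atTop (𝓝 ℓ)) : 0 < ℓ := by
  have hev : ∀ᶠ N in atTop, ((c : ℝ) : EReal) ≤ ((D N : ℝ) : EReal) :=
    eventually_atTop.2 ⟨N₁, fun N hN => EReal.coe_le_coe_iff.2 (hlb N hN)⟩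
  exact lt_of_lt_of_le (EReal.coe_pos.2 hc) (ge_of_tendsto hℓ hev)

/-- If a real sequence `F` tends to a positive real `κ` and agrees eventually with `D`, then `↑(D N)`
tends in `EReal` to the positive limit `↑κ`. [folklore] -/
theorem exists_pos_ereal_tendsto_of_eventuallyEq {D F : ℕ → ℝ} {κ : ℝ} (hκ : 0 < κ)
    (hF : Tendsto F atTop (𝓝 κ)) (hDF : F =ᶠ[atTop] D) :
    ∃ ℓ : EReal, 0 < ℓ ∧ Tendsto (fun N : ℕ => ((D N : ℝ) : EReal)) atTop (𝓝 ℓ) :=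
  ⟨((κ : ℝ) : EReal), EReal.coe_pos.2 hκ, (continuous_coe_real_ereal.tendsto κ).comp (hF.congr' hDF)⟩

/-! ## Necessity of the conductance lower bound (item 11749) -/

/-- **`PositiveOrInfiniteLimit → ConductanceLowerBound`** (route decl of `BondHeatUncertainty` ⇒ crux of
route `JunctionLocality`, item `stmt-AtomisticToContinuum-11749`): both statements carry the same
parameters, uniqueness hypothesis, steady-state family, `T` and response coefficients `D`; the slot's
`EReal` limit `ℓ > 0` gives a real `c ∈ (0, ℓ)` with `c ≤ D N` for all large `N`
(`exists_pos_eventually_le_of_ereal_tendsto`).  Hence the Ohmic lower bound 11749 is a NECESSARY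
condition for item 9128. [folklore] -/
theorem conductanceLowerBound_of_positiveOrInfiniteLimit
    (hL : BondHeatUncertainty.PositiveOrInfiniteLimit) : JunctionLocality.ConductanceLowerBound := by
  intro ω₂ lam β γ hω hl hβ hγ huniq μ hμ T hT D hD
  obtain ⟨ℓ, hℓpos, hℓ⟩ := hL ω₂ lam β γ hω hl hβ hγ huniq μ hμ T hT D hD
  exact exists_pos_eventually_le_of_ereal_tendsto D hℓpos hℓ

/-! ## The exact split: Ohmic lower bound + `EReal`-regularity of the response sequence -/

/-- **The slot is exactly `ConductanceLowerBound` ∧ (regularity of `N ↦ D N` in `EReal`)**: under the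
common hypotheses (parameters, weak-NESS uniqueness, a steady-state family, `T > 0`, response
coefficients `D`), "`↑(D N) → ℓ` for some `ℓ > 0`" holds iff (i) eventually `D N ≥ c > 0` (item 11749) and
(ii) `↑(D N)` has SOME limit in `EReal = [-∞, +∞]` (`liminf = limsup`, no value claimed — the analogue for
`D` of `BoundaryEscapeDeficit.EscapeNonOscillation`).  (⇒) is `conductanceLowerBound_of_positiveOrInfiniteLimit`
plus forgetting positivity; (⇐) the eventual bound makes the limit `≥ ↑c > 0`
(`ereal_limit_pos_of_eventually_le`).  The second conjunct is the residual statement a planner would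
file once 11749 lands. [folklore] -/
theorem positiveOrInfiniteLimit_iff_conductanceLowerBound_and_regular :
    BondHeatUncertainty.PositiveOrInfiniteLimit ↔
      (JunctionLocality.ConductanceLowerBound ∧
        ∀ ω₂ lam β γ : ℝ, 0 < ω₂ → 0 < lam → 0 < β → 0 < γ →
          (∀ (N : ℕ) (T_L T_R : ℝ), 0 < T_L → 0 < T_R →
            ∀ μ ν : MeasureTheory.Measure (PhaseSpace N),
              (pinnedChain ω₂ lam β γ).IsSteadyState N T_L T_R μ →
              (pinnedChain ω₂ lam β γ).IsSteadyState N T_L T_R ν → μ = ν) →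
          ∀ μ : (N : ℕ) → ℝ → ℝ → MeasureTheory.Measure (PhaseSpace N),
            (∀ (N : ℕ) (T_L T_R : ℝ), 0 < T_L → 0 < T_R →
              (pinnedChain ω₂ lam β γ).IsSteadyState N T_L T_R (μ N T_L T_R)) →
            ∀ T : ℝ, 0 < T → ∀ D : ℕ → ℝ,
              (∀ N : ℕ, Tendsto (fun δ : ℝ =>
                  (pinnedChain ω₂ lam β γ).totalCurrent (μ N (T + δ / 2) (T - δ / 2)) / δ)
                (𝓝[≠] 0) (𝓝 (D N))) →
              ∃ ℓ : EReal, Tendsto (fun N : ℕ => ((D N : ℝ) : EReal)) atTop (𝓝 ℓ)) := by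
  constructor
  · intro hL
    refine ⟨conductanceLowerBound_of_positiveOrInfiniteLimit hL, ?_⟩
    intro ω₂ lam β γ hω hl hβ hγ huniq μ hμ T hT D hD
    obtain ⟨ℓ, -, hℓ⟩ := hL ω₂ lam β γ hω hl hβ hγ huniq μ hμ T hT D hD
    exact ⟨ℓ, hℓ⟩
  · rintro ⟨hC, hR⟩ ω₂ lam β γ hω hl hβ hγ huniq μ hμ T hT D hD
    obtain ⟨c, hc, N₁, hlb⟩ := hC ω₂ lam β γ hω hl hβ hγ huniq μ hμ T hT D hD
    obtain ⟨ℓ, hℓ⟩ := hR ω₂ lam β γ hω hl hβ hγ huniq μ hμ T hT D hD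
    exact ⟨ℓ, ereal_limit_pos_of_eventually_le D hc hlb hℓ, hℓ⟩

/-! ## The boundary-escape supply line (route `BoundaryEscapeDeficit`) -/

/-- **`ResponseIdentity → EscapeLaw → PositiveOrInfiniteLimit`** (crux 12237 and target 12234 of route
`BoundaryEscapeDeficit`, by name ⇒ the route decl of `BondHeatUncertainty`): fix parameters, the
uniqueness hypothesis, a steady-state family `μ`, `T > 0` and response coefficients `D`.  For `N ≥ 1`
the response identity gives the `δ`-limit `(N-1)·γ·E_N` of the same difference quotient whose limit is
`D N`, so `D N = (N-1)·γ·E_N` (`tendsto_nhds_unique` along the proper filter `𝓝[≠] 0`); the escape law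
sends `(N-1)·γ·E_N` to some `κ_b > 0`; hence `↑(D N) → ↑κ_b > 0`
(`exists_pos_ereal_tendsto_of_eventuallyEq`). [folklore] -/
theorem positiveOrInfiniteLimit_of_boundaryEscapeDeficit
    (hRI : BoundaryEscapeDeficit.ResponseIdentity) (hE : BoundaryEscapeDeficit.EscapeLaw) :
    BondHeatUncertainty.PositiveOrInfiniteLimit := by
  intro ω₂ lam β γ hω hl hβ hγ huniq μ hμ T hT D hD
  have hR := hRI ω₂ lam β γ hω hl hβ hγ huniq μ hμ T hT
  obtain ⟨κb, hκb, hlim⟩ := hE ω₂ lam β γ hω hl hβ hγ T hT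
  refine exists_pos_ereal_tendsto_of_eventuallyEq hκb hlim ?_
  filter_upwards [eventually_gt_atTop 0] with N hN
  exact tendsto_nhds_unique (hR N hN).2 (hD N)

/-- **The same line from the cruxes of `BoundaryEscapeDeficit`**: `ResponseIdentity → EscapeLawOfCruxes →
HalfChainTailLaw → DiffusiveCrossover → EscapeNonOscillation → PositiveOrInfiniteLimit` (items 12237,
12242, 12235, 12236, 12238 by name; the mesh 12242 turns the three cruxes into `EscapeLaw`).
[folklore] -/
theorem positiveOrInfiniteLimit_of_boundaryEscapeDeficit_cruxes
    (hRI : BoundaryEscapeDeficit.ResponseIdentity) (hG : BoundaryEscapeDeficit.EscapeLawOfCruxes)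
    (hT : BoundaryEscapeDeficit.HalfChainTailLaw) (hC : BoundaryEscapeDeficit.DiffusiveCrossover)
    (hN : BoundaryEscapeDeficit.EscapeNonOscillation) : BondHeatUncertainty.PositiveOrInfiniteLimit :=
  positiveOrInfiniteLimit_of_boundaryEscapeDeficit hRI (hG hT hC hN)

/-- **Conversely, `NessUnique → ResponseIdentity → PositiveOrInfiniteLimit → EscapeNonOscillation`**:
route `BoundaryEscapeDeficit`'s own import slot (item 12238, regularity of `N ↦ (N-1)·γ·E_N` in
`EReal`) follows from item 9128 under that route's hypotheses.  Proof: take the canonical steady-state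
family (in-tree existence `pinnedChain_exists_isSteadyState`, junk `0` at non-positive temperatures);
the response identity supplies response coefficients `D N := (N-1)·γ·E_N` for `N ≥ 1` and the empty
chain has `D 0 := 0` (`totalCurrent_zero`); the slot gives an `EReal` limit of `↑(D N)`, which is
eventually `↑((N-1)·γ·E_N)`. [folklore] -/
theorem escapeNonOscillation_of_positiveOrInfiniteLimit (hU : BoundaryEscapeDeficit.NessUnique)
    (hRI : BoundaryEscapeDeficit.ResponseIdentity) (hL : BondHeatUncertainty.PositiveOrInfiniteLimit) :
    BoundaryEscapeDeficit.EscapeNonOscillation := by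
  intro ω₂ lam β γ hω hl hβ hγ T hT P K E
  classical
  have huniq := hU ω₂ lam β γ hω hl hβ hγ
  -- the canonical steady-state family
  let μ₀ : (N : ℕ) → ℝ → ℝ → MeasureTheory.Measure (PhaseSpace N) := fun N T_L T_R =>
    if h : 0 < T_L ∧ 0 < T_R then
      Classical.choose (pinnedChain_exists_isSteadyState hω hl hβ hγ N h.1 h.2) else 0
  have hμ₀ : ∀ (N : ℕ) (T_L T_R : ℝ), 0 < T_L → 0 < T_R →
      (pinnedChain ω₂ lam β γ).IsSteadyState N T_L T_R (μ₀ N T_L T_R) := by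
    intro N T_L T_R hL' hR'
    simp only [μ₀, dif_pos (And.intro hL' hR')]
    exact Classical.choose_spec (pinnedChain_exists_isSteadyState hω hl hβ hγ N hL' hR')
  have hR := hRI ω₂ lam β γ hω hl hβ hγ huniq μ₀ hμ₀ T hT
  -- response coefficients along μ₀: the escape expression for `N ≥ 1`, `0` for the empty chain
  let D : ℕ → ℝ := fun N => if N = 0 then 0 else ((N : ℝ) - 1) * γ * E N
  have hD : ∀ N : ℕ, Tendsto
      (fun δ : ℝ => (pinnedChain ω₂ lam β γ).totalCurrent (μ₀ N (T + δ / 2) (T - δ / 2)) / δ)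
      (𝓝[≠] 0) (𝓝 (D N)) := by
    intro N
    rcases Nat.eq_zero_or_pos N with rfl | hN
    · have hD0 : D 0 = 0 := by simp [D]
      rw [hD0]
      simp only [OscillatorChain.totalCurrent_zero, zero_div]
      exact tendsto_const_nhds
    · have hDN : D N = ((N : ℝ) - 1) * γ * E N := by simp [D, hN.ne']
      rw [hDN]
      exact (hR N hN).2
  obtain ⟨ℓ, -, hℓ⟩ := hL ω₂ lam β γ hω hl hβ hγ huniq μ₀ hμ₀ T hT D hD
  refine ⟨ℓ, hℓ.congr' ?_⟩
  filter_upwards [eventually_gt_atTop 0] with N hN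
  have hDN : D N = ((N : ℝ) - 1) * γ * E N := by simp [D, hN.ne']
  rw [hDN]

/-! ## The copy of the slot in route `PhononLorentzGas` -/

/-- Route `PhononLorentzGas` files the shared item 9128 verbatim; its decl and `BondHeatUncertainty`'s are
the same proposition (`Iff.rfl`), so every supply line / necessity statement for one is one for the
other. [folklore] -/
theorem phononLorentzGas_positiveOrInfiniteLimit_iff :
    PhononLorentzGas.PositiveOrInfiniteLimit ↔ BondHeatUncertainty.PositiveOrInfiniteLimit :=
  Iff.rfl

/-- In particular route `PhononLorentzGas`'s slot also forces the Ohmic lower bound 11749. [folklore] -/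
theorem conductanceLowerBound_of_phononLorentzGas_positiveOrInfiniteLimit
    (hL : PhononLorentzGas.PositiveOrInfiniteLimit) : JunctionLocality.ConductanceLowerBound :=
  conductanceLowerBound_of_positiveOrInfiniteLimit (phononLorentzGas_positiveOrInfiniteLimit_iff.1 hL)

end Summit.AtomisticToContinuum.FouriersLaw.Theorems.PositiveOrInfiniteLimit

end
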